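import Literature.Computability.Complexity.SymPlusProofs
import Literature.Computability.Complexity.ValiantVaziraniLemma
import HarnessLib

/-!
# Explicit seeds for the randomized `ACC` circuit: Valiant–Vazirani isolation with `O(log³ s)` bits

R. Williams, *Nonuniform ACC circuit lower bounds*, J. ACM 61 (2014), Appendix A (proof of
Lemma 4.1, the algorithmic `ACC ⊆ SYM⁺` conversion), Transformations 1–2: the AND/OR gates of the
circuit are replaced by probabilistic parity tests that share ONE short random seed ("we replace the
gates by … using the Valiant–Vazirani isolation lemma with pairwise independent hash functions, so
that only `poly(log s)` random bits are needed"), and the randomness is then removed by taking the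
MAJORITY over ALL seeds ("enumerate over all possible values of the random bits"), which is what makes
the conversion an algorithm: `2^{poly(log s)}` copies, no search.

The tree's `SymPlusProofs.lean` randomizes a gate by `T₀` parity tests `t` on the seed-selected
argument positions `{a | β j t a}` (`BT.rop`, `BT.rand`; any `β : ℕ → ℕ → ℕ → Bool`) and proves that a
seed good at every gate computes the circuit (`BT.rand_eval_eq`); its seeds, however, are fully
independent bits (`BT.Seed`, `s₀·T₀·s` of them), derandomized by a union bound over the inputs
(`BT.exists_seeds_majority`) — an existence statement. This file supplies the EXPLICIT family:

* parameters (all in `s ≥` size, fan-in): `vvMu s = log₂ s + 1` address bits of an argument position,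
  `vvK s = vvMu s + 2` hash rows, `vvR s = 6 (log₂ s + 2)` independent hash functions,
  `vvT₀ s = vvR s · (vvK s + 1)` tests `t = (r, k)`, `vvBits s = vvR s · vvK s · (vvMu s + 1)` seed
  bits and `vvT s = 2 ^ vvBits s` copies;
* `vvSeed s c t a` — copy `c < vvT s` read as `vvR s` affine hash functions `h_r = (A_r, b_r)` over
  `𝔽₂` (`AffineHash.Hash`, the bits of `c` at the positions `vvIdx`), test `t = (r, k)` selecting the
  argument position `a` iff the first `k` rows of `h_r` vanish on the binary digits of `a`
  (`vvSeed_eq_true_iff`); everything is elementary arithmetic on `c, t, a` (`vvRowSum`: sums of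
  products of binary digits), which is the form the polynomial-time implementation reads;
* **`vv_majority`** — for every circuit `C` with at most `s` gates of fan-in `≤ s` and every input
  `x`, `C x = [vvT s < 2 · #{c < vvT s | (rand m (vvT₀ s) (vvSeed s c) C) x = 1}]`, the hypothesis
  `hmaj` of `BT.Setup.inv_init`. Proof: a copy is wrong only if some AND/OR gate with a nonempty set
  `W` of firing arguments sees an even count in all its tests (`bad_subset`); at the good level
  `k = ⌊log₂ |W|⌋ + 2 ≤ vvK s` (`AffineHash.exists_goodLevel`) at least `1/8` of the hash functions give
  an odd count (`AffineHash.valiant_vazirani_odd_level`), the `vvR s` functions of a seed are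
  independent coordinates (`Fintype.card_piFinset`), so at most a `(7/8)^{vvR s}` fraction of the seeds
  is bad at one gate, and `2 · s · 7^R < 8^R` for `R = 6 (log₂ s + 2)` (`two_mul_mul_seven_pow_lt`).

No new named fact; everything is proved. The seeds are consumed by the explicit Beigel–Tarui
collapse (`BT.Setup` with `βs := vvSeed s`, `T₀ := vvT₀ s`).

## References

* R. Williams, *Nonuniform ACC circuit lower bounds*, J. ACM 61 (2014), Appendix A [Williams2014].
* L. G. Valiant, V. V. Vazirani, *NP is as easy as detecting unique solutions*, TCS 47 (1986);
  S. Arora, B. Barak, *Computational Complexity*, CUP 2009, Lemma 17.19 [AroraBarak2009].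
* R. Beigel, J. Tarui, *On ACC*, Comput. Complexity 4 (1994), Lemma 2.5 [BeigelTarui1994].
-/

namespace Literature.Computability.Complexity

open Finset

namespace BT

/-! ### Parameters -/

/-- Address bits of an argument position: `a < s < 2 ^ vvMu s`. [cite: Williams2014, Appendix A] -/
def vvMu (s : ℕ) : ℕ := Nat.log 2 s + 1

/-- Rows of one hash function (isolation levels `0, …, vvK s`). [cite: Williams2014, Appendix A] -/
def vvK (s : ℕ) : ℕ := vvMu s + 2

/-- Number of independent hash functions in a seed. [cite: Williams2014, Appendix A] -/
def vvR (s : ℕ) : ℕ := 6 * (Nat.log 2 s + 2)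

/-- Number of parity tests per AND/OR gate: one per (hash function, level). [cite: Williams2014, Appendix A] -/
def vvT₀ (s : ℕ) : ℕ := vvR s * (vvK s + 1)

/-- Seed length in bits: `vvR s` hash functions of `vvK s` rows of `vvMu s + 1` entries.
[cite: Williams2014, Appendix A] -/
def vvBits (s : ℕ) : ℕ := vvR s * (vvK s * (vvMu s + 1))

/-- Number of copies: all seeds. [cite: Williams2014, Appendix A] -/
def vvT (s : ℕ) : ℕ := 2 ^ vvBits s

/-- Position in the seed of entry `i` of row `ρ` of hash function `r` (`i = vvMu s` is the affine
part `b_ρ`). [folklore] -/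
def vvIdx (s r ρ i : ℕ) : ℕ := (r * vvK s + ρ) * (vvMu s + 1) + i

/-- Binary digit `n` of `c`, as a natural. [folklore] -/
def bitN (c n : ℕ) : ℕ := c / 2 ^ n % 2

/-- Row `ρ` of hash function `r` of seed `c` applied to the address `a`, before reduction mod `2`:
`Σ_{i < μ} A[ρ,i] · a_i + b_ρ`. [folklore] -/
def vvRowSum (s c r ρ a : ℕ) : ℕ :=
  (((List.range (vvMu s)).map fun i => bitN c (vvIdx s r ρ i) * bitN a i).sum) +
    bitN c (vvIdx s r ρ (vvMu s))

/-- **The seed family.** Test `t = r · (vvK s + 1) + k` of copy `c` selects the argument position `a`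
iff the first `k` rows of the `r`-th hash function of `c` vanish on the digits of `a`
(Valiant–Vazirani isolation at level `k`). [cite: Williams2014, Appendix A] -/
def vvSeed (s c _j t a : ℕ) : Bool :=
  decide (∀ ρ < t % (vvK s + 1), vvRowSum s c (t / (vvK s + 1)) ρ a % 2 = 0)

/-! ### Elementary facts on the parameters -/

/-- `s < 2 ^ vvMu s`. [folklore] -/
theorem lt_two_pow_vvMu (s : ℕ) : s < 2 ^ vvMu s := Nat.lt_pow_succ_log_self one_lt_two s

/-- `bitN c n ≤ 1`. [folklore] -/
theorem bitN_le_one (c n : ℕ) : bitN c n ≤ 1 := Nat.le_of_lt_succ (Nat.mod_lt _ two_pos)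

/-- `bitN` is the test bit. [folklore] -/
theorem bitN_eq_toNat_testBit (c n : ℕ) : bitN c n = (c.testBit n).toNat := (Nat.toNat_testBit c n).symm

/-- `(8/7)^6 > 2`, whence `2^q · 7^(6q) ≤ 8^(6q)`. [folklore] -/
theorem two_pow_mul_seven_pow_le (q : ℕ) : 2 ^ q * 7 ^ (6 * q) ≤ 8 ^ (6 * q) := by
  rw [pow_mul, pow_mul, ← mul_pow]
  exact Nat.pow_le_pow_left (by norm_num) q

/-- **The union bound closes**: `2 · s · 7^R < 8^R` for `R = vvR s = 6 (log₂ s + 2)`. [folklore] -/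
theorem two_mul_mul_seven_pow_lt (s : ℕ) : 2 * s * 7 ^ vvR s < 8 ^ vvR s := by
  have hs : s < 2 ^ (Nat.log 2 s + 1) := Nat.lt_pow_succ_log_self one_lt_two s
  have h := two_pow_mul_seven_pow_le (Nat.log 2 s + 2)
  unfold vvR
  calc 2 * s * 7 ^ (6 * (Nat.log 2 s + 2)) < 2 ^ (Nat.log 2 s + 2) * 7 ^ (6 * (Nat.log 2 s + 2)) := by
        refine Nat.mul_lt_mul_of_pos_right ?_ (Nat.pow_pos (by norm_num))
        rw [pow_succ]; omega
    _ ≤ _ := h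

/-! ### The seed as a tuple of affine hash functions -/

/-- Binary digits of `a` as a vector over `𝔽₂`. [folklore] -/
def bitsZ (μ a : ℕ) : Fin μ → ZMod 2 := fun i => ((bitN a i : ℕ) : ZMod 2)

/-- The `r`-th hash function `(A_r, b_r)` of the seed `c`. [folklore] -/
def hashOf (s c : ℕ) (r : Fin (vvR s)) : AffineHash.Hash (vvMu s) (vvK s) :=
  (Matrix.of fun ρ i => ((bitN c (vvIdx s r ρ i) : ℕ) : ZMod 2),
    fun ρ => ((bitN c (vvIdx s r ρ (vvMu s)) : ℕ) : ZMod 2))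

/-- Row `ρ` of `h_r(bits a)` is `vvRowSum … ρ a` reduced mod `2`. [folklore] -/
theorem hash_hashOf_apply (s c a : ℕ) (r : Fin (vvR s)) (ρ : Fin (vvK s)) :
    AffineHash.hash (hashOf s c r) (bitsZ (vvMu s) a) ρ = ((vvRowSum s c r ρ a : ℕ) : ZMod 2) := by
  simp only [AffineHash.hash, hashOf, bitsZ, Pi.add_apply, Matrix.mulVec, dotProduct, Matrix.of_apply,
    vvRowSum, Nat.cast_add]
  congr 1
  rw [← List.sum_toFinset _ List.nodup_range, List.toFinset_range, Nat.cast_sum, Finset.sum_range]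
  simp [Nat.cast_mul]

/-- Digit sums vanish mod `2` iff their cast to `𝔽₂` vanishes. [folklore] -/
theorem natCast_eq_zero_iff_mod_two (n : ℕ) : ((n : ℕ) : ZMod 2) = 0 ↔ n % 2 = 0 := by
  rw [ZMod.natCast_eq_zero_iff, Nat.dvd_iff_mod_eq_zero]

/-- **The seed test is the Valiant–Vazirani event**: for `t = r (K+1) + k` with `k ≤ K = vvK s`,
`vvSeed s c j t a` holds iff the level-`k` truncation of `h_r` vanishes on the digits of `a` (the
gate index `j` is not used: all gates share the seed). [folklore] -/
theorem vvSeed_eq_true_iff (s c j a : ℕ) (r : Fin (vvR s)) {k : ℕ} (hk : k ≤ vvK s) :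
    vvSeed s c j (r * (vvK s + 1) + k) a = true ↔
      AffineHash.hash (AffineHash.trunc hk (hashOf s c r)) (bitsZ (vvMu s) a) = 0 := by
  have hK : 0 < vvK s + 1 := Nat.succ_pos _
  have hdiv : (r * (vvK s + 1) + k) / (vvK s + 1) = r := by
    rw [Nat.add_comm, Nat.add_mul_div_right _ _ hK, Nat.div_eq_of_lt (Nat.lt_succ_of_le hk), zero_add]
  have hmod : (r * (vvK s + 1) + k) % (vvK s + 1) = k := by
    rw [Nat.add_comm, Nat.add_mul_mod_self_right, Nat.mod_eq_of_lt (Nat.lt_succ_of_le hk)]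
  rw [vvSeed, hdiv, hmod, decide_eq_true_iff, funext_iff]
  constructor
  · intro h ρ
    rw [AffineHash.hash_trunc_apply, hash_hashOf_apply, Pi.zero_apply, natCast_eq_zero_iff_mod_two]
    exact h ρ ρ.2
  · intro h ρ hρ
    have := h ⟨ρ, hρ⟩
    rwa [AffineHash.hash_trunc_apply, hash_hashOf_apply, Pi.zero_apply, natCast_eq_zero_iff_mod_two] at this

/-- Digits below `μ` determine a number `< 2^μ`: `bitsZ μ` is injective on `[0, 2^μ)`. [folklore] -/
theorem bitsZ_injOn (μ : ℕ) {a a' : ℕ} (ha : a < 2 ^ μ) (ha' : a' < 2 ^ μ)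
    (h : bitsZ μ a = bitsZ μ a') : a = a' := by
  refine Nat.eq_of_testBit_eq fun i => ?_
  by_cases hi : i < μ
  · have h1 := congrFun h ⟨i, hi⟩
    simp only [bitsZ] at h1
    rw [ZMod.natCast_eq_natCast_iff', Nat.mod_eq_of_lt (Nat.lt_succ_of_le (bitN_le_one _ _)),
      Nat.mod_eq_of_lt (Nat.lt_succ_of_le (bitN_le_one _ _)), bitN_eq_toNat_testBit,
      bitN_eq_toNat_testBit] at h1
    cases h2 : a.testBit i <;> cases h3 : a'.testBit i <;> simp [h2, h3] at h1 ⊢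
  · have hμ : 2 ^ μ ≤ 2 ^ i := Nat.pow_le_pow_right two_pos (not_lt.1 hi)
    rw [Nat.testBit_eq_false_of_lt (lt_of_lt_of_le ha hμ),
      Nat.testBit_eq_false_of_lt (lt_of_lt_of_le ha' hμ)]

/-- The seed positions are pairwise distinct and fill `[0, vvBits s)`: decoding a position. [folklore] -/
theorem vvIdx_decode (s : ℕ) {N : ℕ} (hN : N < vvBits s) :
    ∃ (r : Fin (vvR s)) (ρ : Fin (vvK s)) (i : ℕ), i ≤ vvMu s ∧ vvIdx s r ρ i = N := by
  have hM : 0 < vvMu s + 1 := Nat.succ_pos _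
  have hK : 0 < vvK s := by unfold vvK; omega
  set q := N / (vvMu s + 1) with hq
  have hqlt : q < vvR s * vvK s := by
    rw [hq, Nat.div_lt_iff_lt_mul hM]
    unfold vvBits at hN
    simpa [mul_assoc] using hN
  have hr : q / vvK s < vvR s := by
    rw [Nat.div_lt_iff_lt_mul hK]; exact hqlt
  refine ⟨⟨q / vvK s, hr⟩, ⟨q % vvK s, Nat.mod_lt _ hK⟩, N % (vvMu s + 1),
    Nat.le_of_lt_succ (Nat.mod_lt _ hM), ?_⟩
  show (q / vvK s * vvK s + q % vvK s) * (vvMu s + 1) + N % (vvMu s + 1) = N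
  rw [Nat.div_add_mod' q (vvK s), hq, Nat.div_add_mod' N (vvMu s + 1)]

/-- A seed position lies below `vvBits s`. [folklore] -/
theorem vvIdx_lt (s : ℕ) (r : Fin (vvR s)) (ρ : Fin (vvK s)) {i : ℕ} (hi : i ≤ vvMu s) :
    vvIdx s r ρ i < vvBits s := by
  unfold vvIdx vvBits
  have h1 : (r : ℕ) * vvK s + ρ < vvR s * vvK s := by
    have hr := r.2; have hρ := ρ.2
    calc (r : ℕ) * vvK s + ρ < r * vvK s + vvK s := by omega
      _ = (r + 1) * vvK s := by ring
      _ ≤ vvR s * vvK s := Nat.mul_le_mul_right _ hr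
  calc ((r : ℕ) * vvK s + ρ) * (vvMu s + 1) + i < ((r : ℕ) * vvK s + ρ) * (vvMu s + 1) + (vvMu s + 1) := by omega
    _ = ((r : ℕ) * vvK s + ρ + 1) * (vvMu s + 1) := by ring
    _ ≤ (vvR s * vvK s) * (vvMu s + 1) := Nat.mul_le_mul_right _ h1
    _ = vvR s * (vvK s * (vvMu s + 1)) := by ring

/-- Reading the entries of `hashOf` back as digits of the seed. [folklore] -/
theorem bitN_eq_of_hashOf_eq (s : ℕ) {c c' : ℕ} (h : hashOf s c = hashOf s c') (r : Fin (vvR s))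
    (ρ : Fin (vvK s)) {i : ℕ} (hi : i ≤ vvMu s) : bitN c (vvIdx s r ρ i) = bitN c' (vvIdx s r ρ i) := by
  have hr := congrFun h r
  simp only [hashOf, Prod.mk.injEq] at hr
  have key : ((bitN c (vvIdx s r ρ i) : ℕ) : ZMod 2) = ((bitN c' (vvIdx s r ρ i) : ℕ) : ZMod 2) := by
    rcases Nat.lt_or_ge i (vvMu s) with hlt | hge
    · have := (Matrix.ext_iff.2 hr.1) ρ ⟨i, hlt⟩
      simpa [Matrix.of_apply] using this
    · have hieq : i = vvMu s := le_antisymm hi hge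
      subst hieq
      exact congrFun hr.2 ρ
  rwa [ZMod.natCast_eq_natCast_iff', Nat.mod_eq_of_lt (Nat.lt_succ_of_le (bitN_le_one _ _)),
    Nat.mod_eq_of_lt (Nat.lt_succ_of_le (bitN_le_one _ _))] at key

/-- **Seeds below `vvT s` are determined by their hash functions.** [folklore] -/
theorem hashOf_injOn (s : ℕ) {c c' : ℕ} (hc : c < vvT s) (hc' : c' < vvT s)
    (h : hashOf s c = hashOf s c') : c = c' := by
  refine Nat.eq_of_testBit_eq fun N => ?_
  by_cases hN : N < vvBits s
  · obtain ⟨r, ρ, i, hi, hidx⟩ := vvIdx_decode s hN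
    have hb := bitN_eq_of_hashOf_eq s h r ρ hi
    rw [hidx, bitN_eq_toNat_testBit, bitN_eq_toNat_testBit] at hb
    cases h2 : c.testBit N <;> cases h3 : c'.testBit N <;> simp [h2, h3] at hb ⊢
  · have hle : 2 ^ vvBits s ≤ 2 ^ N := Nat.pow_le_pow_right two_pos (not_lt.1 hN)
    unfold vvT at hc hc'
    rw [Nat.testBit_eq_false_of_lt (lt_of_lt_of_le hc hle),
      Nat.testBit_eq_false_of_lt (lt_of_lt_of_le hc' hle)]

/-- `|Hash μ K| = 2^{K (μ + 1)}`. [folklore] -/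
theorem card_hash (μ K : ℕ) : Fintype.card (AffineHash.Hash μ K) = 2 ^ (K * (μ + 1)) := by
  rw [show Fintype.card (AffineHash.Hash μ K) =
      Fintype.card (Matrix (Fin K) (Fin μ) (ZMod 2)) * Fintype.card (Fin K → ZMod 2) from Fintype.card_prod _ _,
    show Fintype.card (Matrix (Fin K) (Fin μ) (ZMod 2)) = Fintype.card (Fin K → Fin μ → ZMod 2) from rfl]
  simp only [Fintype.card_fun, ZMod.card, Fintype.card_fin]
  rw [← pow_mul, ← pow_add]; congr 1; ring

/-- `|seed tuples| = vvT s`. [folklore] -/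
theorem card_hashTuples (s : ℕ) : Fintype.card (Fin (vvR s) → AffineHash.Hash (vvMu s) (vvK s)) = vvT s := by
  rw [Fintype.card_fun, card_hash, Fintype.card_fin, ← pow_mul, vvT, vvBits]; congr 1; ring

/-! ### Counting the bad seeds -/

section majority

variable {n s : ℕ} (m : ℕ)

/-- The arguments selected by test `(r, k)` among those of polarity `pol` are, through their digit
vectors, the points of `S = digits(W_pol)` hashed to `0` by the level-`k` truncation of `h_r`. [folklore] -/
theorem card_selected_eq (g : Gate (Fin n)) (hk : g.arity ≤ s) (v : Fin g.arity → Bool) (pol : Bool) (c j : ℕ)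
    (r : Fin (vvR s)) {k : ℕ} (hkK : k ≤ vvK s) :
    #(univ.filter fun a : Fin g.arity => v a = pol ∧ vvSeed s c j (r * (vvK s + 1) + k) a = true) =
      #(((univ.filter fun a : Fin g.arity => v a = pol).image fun a : Fin g.arity => bitsZ (vvMu s) (a : ℕ)).filter
        fun y => AffineHash.hash (AffineHash.trunc hkK (hashOf s c r)) y = 0) := by
  have hinj : Set.InjOn (fun a : Fin g.arity => bitsZ (vvMu s) (a : ℕ))
      ↑(univ.filter fun a : Fin g.arity => v a = pol) := by
    intro a _ a' _ h
    have ha : (a : ℕ) < 2 ^ vvMu s := lt_of_lt_of_le a.2 (hk.trans (lt_two_pow_vvMu s).le)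
    have ha' : (a' : ℕ) < 2 ^ vvMu s := lt_of_lt_of_le a'.2 (hk.trans (lt_two_pow_vvMu s).le)
    exact Fin.ext (bitsZ_injOn (vvMu s) ha ha' h)
  rw [Finset.filter_image, Finset.card_image_of_injOn (fun a ha a' ha' h => hinj
    (Finset.mem_of_mem_filter _ ha) (Finset.mem_of_mem_filter _ ha') h), Finset.filter_filter]
  congr 1
  ext a
  simp only [mem_filter, mem_univ, true_and, vvSeed_eq_true_iff s c j a r hkK]

/-- **The isolation bound at one gate** (one polarity): if some argument has polarity `pol`, the
seeds none of whose tests sees an odd number of selected arguments of polarity `pol` are at most a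
`(7/8)^{vvR s}` fraction: at the good level of `|W_pol|` each of the `vvR s` independent hash
functions isolates an odd number with probability `≥ 1/8` (Valiant–Vazirani). [cite: Williams2014, Appendix A] -/
theorem card_noOddTest_le (g : Gate (Fin n)) (hk : g.arity ≤ s) (v : Fin g.arity → Bool) (pol : Bool)
    (j : ℕ) (hex : ∃ a₀, v a₀ = pol) :
    8 ^ vvR s * #(univ.filter fun c : Fin (vvT s) =>
        ¬ ∃ t < vvT₀ s, Odd #(univ.filter fun a : Fin g.arity => v a = pol ∧ vvSeed s c j t a = true)) ≤
      7 ^ vvR s * vvT s := by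
  classical
  obtain ⟨a₀, ha₀⟩ := hex
  set W : Finset (Fin g.arity) := univ.filter fun a => v a = pol with hW
  set S : Finset (Fin (vvMu s) → ZMod 2) := W.image fun a : Fin g.arity => bitsZ (vvMu s) (a : ℕ) with hS
  have hinjW : Set.InjOn (fun a : Fin g.arity => bitsZ (vvMu s) (a : ℕ)) ↑W := by
    intro a _ a' _ h
    have ha : (a : ℕ) < 2 ^ vvMu s := lt_of_lt_of_le a.2 (hk.trans (lt_two_pow_vvMu s).le)
    have ha' : (a' : ℕ) < 2 ^ vvMu s := lt_of_lt_of_le a'.2 (hk.trans (lt_two_pow_vvMu s).le)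
    exact Fin.ext (bitsZ_injOn (vvMu s) ha ha' h)
  have hSW : #S = #W := Finset.card_image_of_injOn hinjW
  have hW1 : 1 ≤ #W := Finset.card_pos.2 ⟨a₀, by simp [hW, ha₀]⟩
  have hWle : #W ≤ 2 ^ vvMu s :=
    (Finset.card_le_univ W).trans (by rw [Fintype.card_fin]; exact hk.trans (lt_two_pow_vvMu s).le)
  obtain ⟨k, hkK, hlo, hhi⟩ := AffineHash.exists_goodLevel hW1 hWle
  have hkK' : k ≤ vvK s := hkK
  -- the hash functions with an even count at level `k`
  set EV : Finset (AffineHash.Hash (vvMu s) (vvK s)) := univ.filter fun h =>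
    ¬ Odd #(S.filter fun y => AffineHash.hash (AffineHash.trunc hkK' h) y = 0) with hEV
  have hVV := AffineHash.valiant_vazirani_odd_level S hkK' (by rw [hSW]; exact hlo) (by rw [hSW]; exact hhi)
  have hEVle : 8 * #EV ≤ 7 * Fintype.card (AffineHash.Hash (vvMu s) (vvK s)) := by
    have hsplit := Finset.card_filter_add_card_filter_not
      (s := (univ : Finset (AffineHash.Hash (vvMu s) (vvK s))))
      (fun h => Odd #(S.filter fun y => AffineHash.hash (AffineHash.trunc hkK' h) y = 0))
    rw [Finset.card_univ] at hsplit
    rw [hEV]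
    omega
  -- bad seeds have all their hash functions in `EV`
  have hsub : ∀ c : Fin (vvT s),
      (¬ ∃ t < vvT₀ s, Odd #(univ.filter fun a : Fin g.arity => v a = pol ∧ vvSeed s c j t a = true)) →
        ∀ r : Fin (vvR s), hashOf s c r ∈ EV := by
    intro c hc r
    rw [hEV, mem_filter]
    refine ⟨mem_univ _, fun hodd => hc ⟨r * (vvK s + 1) + k, ?_, ?_⟩⟩
    · have hr := r.2
      calc (r : ℕ) * (vvK s + 1) + k < r * (vvK s + 1) + (vvK s + 1) := by omega
        _ = (r + 1) * (vvK s + 1) := by ring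
        _ ≤ vvR s * (vvK s + 1) := Nat.mul_le_mul_right _ hr
    · rwa [card_selected_eq g hk v pol c j r hkK']
  -- hence they inject into the tuples over `EV`
  have hcard : #(univ.filter fun c : Fin (vvT s) =>
      ¬ ∃ t < vvT₀ s, Odd #(univ.filter fun a : Fin g.arity => v a = pol ∧ vvSeed s c j t a = true)) ≤
      #EV ^ vvR s := by
    have hpi : #(Fintype.piFinset fun _ : Fin (vvR s) => EV) = #EV ^ vvR s := by
      rw [Fintype.card_piFinset, prod_const, card_univ, Fintype.card_fin]
    rw [← hpi]
    refine Finset.card_le_card_of_injOn (fun c => hashOf s c) (fun c hc => ?_) (fun c hc c' hc' h => ?_)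
    · rw [Finset.mem_coe, mem_filter] at hc
      rw [Finset.mem_coe, Fintype.mem_piFinset]
      exact hsub c hc.2
    · exact Fin.ext (hashOf_injOn s c.2 c'.2 h)
  calc 8 ^ vvR s * _ ≤ 8 ^ vvR s * #EV ^ vvR s := Nat.mul_le_mul_left _ hcard
    _ = (8 * #EV) ^ vvR s := by rw [mul_pow]
    _ ≤ (7 * Fintype.card (AffineHash.Hash (vvMu s) (vvK s))) ^ vvR s := Nat.pow_le_pow_left hEVle _
    _ = 7 ^ vvR s * vvT s := by
        rw [mul_pow, ← card_hashTuples s, Fintype.card_fun, Fintype.card_fin]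

/-- **At one gate at most a `(7/8)^{vvR s}` fraction of the seeds is bad** (AND/OR gates by the
isolation bound, other gates are never randomized). [cite: Williams2014, Appendix A] -/
theorem card_badOp_vv_le (g : Gate (Fin n)) (hk : g.arity ≤ s) (v : Fin g.arity → Bool) (j : ℕ) :
    8 ^ vvR s * #(univ.filter fun c : Fin (vvT s) => BadOp m (vvT₀ s) (vvSeed s c) j g v) ≤
      7 ^ vvR s * vvT s := by
  classical
  have hempty : (univ.filter fun c : Fin (vvT s) => BadOp m (vvT₀ s) (vvSeed s c) j g v) = ∅ →
      8 ^ vvR s * #(univ.filter fun c : Fin (vvT s) => BadOp m (vvT₀ s) (vvSeed s c) j g v) ≤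
        7 ^ vvR s * vvT s := fun h => by rw [h]; simp
  by_cases h1 : accCode m g.fn = 1
  · by_cases hall : ∀ a, v a = true
    · refine hempty (filter_eq_empty_iff.2 fun c _ hbad => hbad ?_)
      rw [op_and_of_accCode h1, rop_of_accCode_one h1]
      simp [hall]
    · obtain ⟨a₀, ha₀⟩ := not_forall.1 hall
      have ha₀' : v a₀ = false := by simpa using ha₀
      refine le_trans (Nat.mul_le_mul_left _ (card_le_card fun c hc => ?_))
        (card_noOddTest_le g hk v false j ⟨a₀, ha₀'⟩)
      simp only [mem_filter, mem_univ, true_and] at hc ⊢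
      unfold BadOp at hc
      rw [op_and_of_accCode h1, rop_of_accCode_one h1] at hc
      have hfalse : decide (∀ i, v i = true) = false := by simpa using ⟨a₀, ha₀'⟩
      intro hex
      apply hc
      show (!decide _) = decide (∀ i, v i = true)
      rw [decide_eq_true hex, hfalse]
      rfl
  by_cases h2 : accCode m g.fn = 2
  · by_cases hall : ∀ a, v a = false
    · refine hempty (filter_eq_empty_iff.2 fun c _ hbad => hbad ?_)
      rw [op_or_of_accCode h2, rop_of_accCode_two h2]
      simp [hall]
    · obtain ⟨a₀, ha₀⟩ := not_forall.1 hall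
      have ha₀' : v a₀ = true := by simpa using ha₀
      refine le_trans (Nat.mul_le_mul_left _ (card_le_card fun c hc => ?_))
        (card_noOddTest_le g hk v true j ⟨a₀, ha₀'⟩)
      simp only [mem_filter, mem_univ, true_and] at hc ⊢
      unfold BadOp at hc
      rw [op_or_of_accCode h2, rop_of_accCode_two h2] at hc
      have htrue : decide (∃ i, v i = true) = true := by simpa using ⟨a₀, ha₀'⟩
      intro hex
      apply hc
      show decide _ = decide (∃ i, v i = true)
      rw [decide_eq_true hex, htrue]
  · refine hempty (filter_eq_empty_iff.2 fun c _ hbad => hbad ?_)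
    rw [rop_of_ne_of_ne h1 h2]

/-- Badness of the seed `c` at gate `j` of `C` on input `x`: the randomized gate disagrees with the
gate on the true values of its arguments. [folklore] -/
def VVBadAt (m s : ℕ) (C : Circuit (Fin n)) (x : Fin n → Bool) (c : ℕ) (j : Fin C.gates.length) : Prop :=
  BadOp m (vvT₀ s) (vvSeed s c) j (C.gates[(j : ℕ)]) fun a => tval C x ((C.gates[(j : ℕ)]).args a)

/-- Decidability of `VVBadAt`. [folklore] -/
instance (m s : ℕ) (C : Circuit (Fin n)) (x : Fin n → Bool) (c : ℕ) (j : Fin C.gates.length) :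
    Decidable (VVBadAt m s C x c j) := inferInstanceAs (Decidable (BadOp _ _ _ _ _ _))

/-- A seed bad at no gate is good. [folklore] -/
theorem goodSeed_of_not_vvBadAt {C : Circuit (Fin n)} {x : Fin n → Bool} {c : ℕ}
    (h : ¬ ∃ j, VVBadAt m s C x c j) : GoodSeed (m := m) (T₀ := vvT₀ s) (vvSeed s c) C x :=
  fun j hj => not_not.1 fun hne => h ⟨⟨j, hj⟩, hne⟩

/-- **All seeds bad for the input `x`**: at most an `s · (7/8)^{vvR s}` fraction, by the union
bound over the gates. [cite: Williams2014, Appendix A] -/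
theorem card_badSeeds_le (C : Circuit (Fin n)) (hsize : C.gates.length ≤ s) (hfan : C.maxFanIn ≤ s)
    (x : Fin n → Bool) :
    8 ^ vvR s * #(univ.filter fun c : Fin (vvT s) => ∃ j, VVBadAt m s C x c j) ≤ s * (7 ^ vvR s * vvT s) := by
  classical
  set Bd : Fin C.gates.length → Finset (Fin (vvT s)) := fun j => univ.filter fun c => VVBadAt m s C x c j
    with hBd
  have hunion : (univ.filter fun c : Fin (vvT s) => ∃ j, VVBadAt m s C x c j) ⊆
      (univ : Finset (Fin C.gates.length)).biUnion Bd := by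
    intro c hc
    simp only [mem_filter, mem_univ, true_and] at hc
    obtain ⟨j, hj⟩ := hc
    simp only [mem_biUnion, mem_univ, true_and, hBd, mem_filter]
    exact ⟨j, hj⟩
  have hj : ∀ j : Fin C.gates.length, 8 ^ vvR s * #(Bd j) ≤ 7 ^ vvR s * vvT s := fun j =>
    card_badOp_vv_le m (C.gates[(j : ℕ)]) ((arity_le_maxFanIn C (List.getElem_mem j.2)).trans hfan) _ j
  calc 8 ^ vvR s * _ ≤ 8 ^ vvR s * #((univ : Finset (Fin C.gates.length)).biUnion Bd) :=
        Nat.mul_le_mul_left _ (card_le_card hunion)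
    _ ≤ 8 ^ vvR s * ∑ j, #(Bd j) := Nat.mul_le_mul_left _ card_biUnion_le
    _ = ∑ j, 8 ^ vvR s * #(Bd j) := by rw [mul_sum]
    _ ≤ ∑ _j : Fin C.gates.length, 7 ^ vvR s * vvT s := sum_le_sum fun j _ => hj j
    _ = C.gates.length * (7 ^ vvR s * vvT s) := by simp
    _ ≤ s * (7 ^ vvR s * vvT s) := Nat.mul_le_mul_right _ hsize

/-- **Fewer than half of the seeds are bad.** [cite: Williams2014, Appendix A] -/
theorem two_mul_card_badSeeds_lt (C : Circuit (Fin n)) (hsize : C.gates.length ≤ s) (hfan : C.maxFanIn ≤ s)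
    (x : Fin n → Bool) :
    2 * #(univ.filter fun c : Fin (vvT s) => ∃ j, VVBadAt m s C x c j) < vvT s := by
  have h := card_badSeeds_le m C hsize hfan x
  have hlt := two_mul_mul_seven_pow_lt s
  have hT : 0 < vvT s := Nat.two_pow_pos _
  set B := #(univ.filter fun c : Fin (vvT s) => ∃ j, VVBadAt m s C x c j)
  have key : 8 ^ vvR s * (2 * B) < 8 ^ vvR s * vvT s :=
    calc 8 ^ vvR s * (2 * B) = 2 * (8 ^ vvR s * B) := by ring
      _ ≤ 2 * (s * (7 ^ vvR s * vvT s)) := Nat.mul_le_mul_left _ h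
      _ = (2 * s * 7 ^ vvR s) * vvT s := by ring
      _ < 8 ^ vvR s * vvT s := Nat.mul_lt_mul_of_pos_right hlt hT
  exact Nat.lt_of_mul_lt_mul_left key

/-- **Majority over all seeds computes the circuit** (Williams 2014, App. A, Transformation 2:
"take the MAJORITY over all `2^{poly(log s)}` assignments to the random bits"; Beigel–Tarui 1994,
Lemma 2.5): for every circuit with at most `s` gates of fan-in `≤ s` and every input `x`, more than
half of the `vvT s` randomized copies agree with `C` on `x`. This is the hypothesis `hmaj` of
`BT.Setup.inv_init` for the explicit seeds. [cite: Williams2014, Appendix A] -/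
theorem vv_majority (C : Circuit (Fin n)) (hsize : C.gates.length ≤ s) (hfan : C.maxFanIn ≤ s)
    (x : Fin n → Bool) :
    C.eval x = decide (vvT s < 2 * #(univ.filter fun c : Fin (vvT s) =>
      (rand m (vvT₀ s) (vvSeed s c) C).eval x = true)) := by
  classical
  set Bd := univ.filter fun c : Fin (vvT s) => ∃ j, VVBadAt m s C x c j with hBd
  have hgood : ∀ c : Fin (vvT s), c ∉ Bd → (rand m (vvT₀ s) (vvSeed s c) C).eval x = C.eval x := by
    intro c hc
    refine rand_eval_eq (goodSeed_of_not_vvBadAt m fun hb => hc ?_)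
    simp only [hBd, mem_filter, mem_univ, true_and]
    exact hb
  have hBdlt : 2 * #Bd < vvT s := two_mul_card_badSeeds_lt m C hsize hfan x
  set Wn := univ.filter fun c : Fin (vvT s) => (rand m (vvT₀ s) (vvSeed s c) C).eval x = true with hWn
  cases hCx : C.eval x
  · have : Wn ⊆ Bd := by
      intro c hc
      by_contra hcB
      have := hgood c hcB
      simp only [hWn, mem_filter, mem_univ, true_and] at hc
      rw [hc, hCx] at this
      exact Bool.noConfusion this
    have := card_le_card this
    symm; simp only [decide_eq_false_iff_not, not_lt]
    omega
  · have : Bdᶜ ⊆ Wn := by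
      intro c hc
      rw [mem_compl] at hc
      simp only [hWn, mem_filter, mem_univ, true_and]
      rw [hgood c hc, hCx]
    have h1 := card_le_card this
    rw [card_compl, Fintype.card_fin] at h1
    symm; simp only [decide_eq_true_eq]
    omega

end majority

end BT

end Literature.Computability.Complexity
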